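import Summits.QuantumFields.YangMills.Theorems.BalabanUVNodesN12DirectSurjSiteBlockCurved
import Summits.QuantumFields.YangMills.Theorems.BalabanUVNodesN12DirectSurjHullCount

/-!
# BalabanUVNodes ∕ N12 — (P4)′ road: the UNIFORM ROW BOUND in seminorm form and the CURVED SITE BLOCK with the seminorm letter on the RANGE of the flat block only — the two
# LOCAL editions of `…N12DirectSurjSiteBlockCurved` (p662488) that let the (P4)′ threshold and letter be written WITHOUT the torus bond count `C_p = #PBond`

Cell `pub-ymgap` (HUMAN RULINGS D-0062 ∕ D-0149), WIDTH SEAT `pub-ymgap-dag-n12-w6` g9 (node N12 = [B15]; key K1⁹ `stmt-QuantumFields-27364`, `--kind proof --supports … --as helper`;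
count-neutral).  THEOREMS ONLY (0 `def`, 0 `instance`, 0 `sorry`).  Lane word dag-n12-c g23 (2026-08-29, CLAIM-3 «closed-form display edition», GO): producer-side siblings only.

WHY.  In p662488 the (δ₂)♯ component letter `‖(DΨ_{U₀}(0) − DΦ♭(0)) w‖_i ≤ C·δ·p(w)` (any seminorm `p ≥ ℓ²(op)`) is converted to the sup norm through a GLOBAL letter `p ≤ C_p‖·‖`,
and the socket of record instantiates `p := #PBond·‖·‖∞`, `C_p = #PBond` (`…HsurjSupportPrelim.exists_cardSeminorm`); so the (P4)′ threshold (`C₂(Dε)(C_pC_Φ) ≤ ½`) and the row letter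
`Λ = Λ₀ + C₁ρ₁C_p + 1` read the torus bond count IN VALUE (dag-n12-w6 g9 LOCATED-ε∕B-VALUE).  But each of the two consumers uses `p ≤ C_p‖·‖` exactly ONCE and on a LOCALISED field:
the row bound on `AX := Ad(u(b₊))X_b` (same support as `X`), the curved block on `Φ(ext t)` (the flat block's output, supported in the block).  Hence the two editions below: the row bound
in `p`-FORM (`‖(DΨ_{U₀}(0)X)_i‖ ≤ Λ₀‖X‖ + C·δ·p(X)`, for `Ad`-invariant `p`) and the curved block with the letter `p(Φv) ≤ C_p‖Φv‖` on the RANGE of `Φ` only — proofs = p662488's verbatim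
but for those two lines.  With `p := ℓ²(HS)` a consumer takes `C_p := √#(block or tower bonds) ≤ √(2d·L^{kd})` (p689329 `card_hullLevel_le`), free of `#PBond`.

CONTENTS.  ★ `exists_rowBound_p`, ★★★ `exists_curved_siteBlock_local`; §6 `seminorm_le_of_twoSites` (the local `C_p` letter over ≤ 2 sites), `threshold_closedForm` (closed-form `ε`).

HONEST FRAMING.  Bookkeeping by name (this lineage's p662488 proofs with one hypothesis reshaped each); per-height (δ₂)♯ constants `C ρ` remain compactness EXISTENTIALS (census U4 proper,
uncommissioned); print's volume-free (46) NOT claimed; nothing of Bałaban's asserted or refuted; N12 NOT discharged; K1⁹ NOT closed; count-neutral; R4 closes only the conditional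
finite-`𝕋⁴` rung `BalabanLadder.UV`; no summit statement is proved here and NOT the Yang–Mills mass gap (Clay).
-/

noncomputable section

open scoped BigOperators Matrix.Norms.L2Operator Topology
open Filter Finset

namespace Summit.QuantumFields.YangMills.BalabanUVNodes.N12DirectSurjSiteBlockCurvedLocal

open Literature.MathematicalPhysics.QuantumFieldTheory.Balaban1983to89
open T4Continuum (T4Family)
open T4ReflectionConeSharp (TwoBlockLocal twoBlockLocal_blockAvg)
open BlockAveragingEMLLinearised (linAvg)
open T4AdjointCovarianceUnitary (lieSU)
open B15DeterminingSets
open B14.Eq213DetSet (Bj)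
open B5Eq118OneStroke (iterBlockOf iterBlock iterBlockOf_zero iterBlockOf_succ)
open Node00
open Literature.MathematicalPhysics.QuantumFieldTheory.Balaban1983to89.Node00 (qLin_gaugeAct_avOfRecord smallBelow_gaugeAct)
open Summit.QuantumFields.YangMills.BalabanUVNodes.N12NearFlatDelta2Letter (exists_delta2_letter exists_guard_of_nearFlat)
open Summit.QuantumFields.YangMills.BalabanUVNodes.N12NearFlatDelta2LetterComponent (fderiv_apply_eq_fderiv_component)
open Summit.QuantumFields.YangMills.BalabanUVNodes.N12DirectSurjSharpDelta2
open Summit.QuantumFields.YangMills.BalabanUVNodes.N12DirectSurjSiteBlockCurved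
open Summit.QuantumFields.YangMills.BalabanUVNodes.N12DirectSurjHullCount (mem_hullLevel_iff card_hullLevel_le)

section Record

variable {F : T4Family} {N : ℕ} [NeZero N] {K k : ℕ}

/-! ## §4b  A uniform row bound at the curved configuration, from one flattening gauge per row -/

/-- ★ **UNIFORM ROW BOUND.**  ONE `C ≥ 0`, `ρ > 0` per height: for `U₀` in the fibre with the guard, a constrained index `i`, and a gauge `u` with `U₀^u` `δ`-near-flat (`δ < ρ`) on the sharp
tower of row `i`, and any letter `Λ₀` of the FLAT chart derivative `DΦ♭(0)` (which does not depend on `U₀`): `‖(DΨ_{U₀}(0)X)_i‖ ≤ (Λ₀ + C·δ·Cp)·‖X‖` — covariance (§4, `Ad` is an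
isometry) + (δ₂)♯ (§3).  `p`-FORM EDITION (dag-n12-w6 g9): for an `Ad`-INVARIANT seminorm `p` (`p(Ad(g)·X) ≤ p(X)`, e.g. `ℓ²(HS)`), the bound is displayed as `Λ₀‖X‖ + C·δ·p(X)` — no
global `p ≤ C_p‖·‖` letter; a consumer localises `X` to the sharp tower of row `i` first. [cite: Balaban1985Variational, (153) p.301, (44)-(47) p.285; Balaban1989LargeFieldII, (1.12)-(1.13) p.359] -/
theorem exists_rowBound_p (k : ℕ)
    (Q : (i : ℕ) → (PBond (F.P K) 0 → Matrix (Fin N) (Fin N) ℂ) → PBond (F.P K) i → Matrix (Fin N) (Fin N) ℂ)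
    (hQ0 : ∀ Y, Q 0 Y = Y) (hQs : ∀ (i : ℕ) (Y : PBond (F.P K) 0 → Matrix (Fin N) (Fin N) ℂ) (c : PBond (F.P K) (i + 1)), Q (i + 1) Y c = linAvg (Q i Y) c)
    (p : Seminorm ℝ (PBond (F.P K) 0 → lieSU (Fin N)))
    (hp : ∀ Y : PBond (F.P K) 0 → lieSU (Fin N), ∑ b, ‖(Y b : Matrix (Fin N) (Fin N) ℂ)‖ ^ 2 ≤ p Y ^ 2)
    (hpAd : ∀ (g : PBond (F.P K) 0 → SU N) (Y : PBond (F.P K) 0 → lieSU (Fin N)), p (fun b => T4AdjointCovarianceUnitary.specialUnitaryAd (g b) (Y b)) ≤ p Y) :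
    ∃ C ρ : ℝ, 0 ≤ C ∧ 0 < ρ ∧
      ∀ (𝔹 : DetSet (F.P K)) (_ : ∀ j, k < j → 𝔹 j = ∅) (_ : k ≤ (F.P K).m + (F.P K).K) (W : MSField (F.P K) (SU N)) (U₀ : GaugeField (F.P K) 0 (SU N))
        (_ : AgreeOn 𝔹 (avgFamily (avOfRecord F N K) U₀) W) (_ : SmallBelow (avOfRecord F N K) k U₀) (i : Fin (constrCard 𝔹 k))
        (u : GaugeTransf (F.P K) 0 (SU N)) ⦃δ : ℝ⦄ (_ : 0 ≤ δ) (_ : δ < ρ)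
        (_ : ∀ b₀ : PBond (F.P K) 0,
          (iterBlockOf (((constrEnum 𝔹 k).symm i).1 : ℕ) b₀.src = ((constrEnum 𝔹 k).symm i).2.1.src ∨
            iterBlockOf (((constrEnum 𝔹 k).symm i).1 : ℕ) b₀.src = ((constrEnum 𝔹 k).symm i).2.1.tgt) →
          (iterBlockOf (((constrEnum 𝔹 k).symm i).1 : ℕ) b₀.tgt = ((constrEnum 𝔹 k).symm i).2.1.src ∨
            iterBlockOf (((constrEnum 𝔹 k).symm i).1 : ℕ) b₀.tgt = ((constrEnum 𝔹 k).symm i).2.1.tgt) →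
          ‖((GaugeField.gaugeAct u U₀ b₀ : SU N) : Matrix (Fin N) (Fin N) ℂ) - 1‖ ≤ δ)
        {Λ₀ : ℝ} (_ : 0 ≤ Λ₀)
        (_ : ∀ Y, ‖fderiv ℝ (msChart F N K k 𝔹 (avgFamily (avOfRecord F N K) (1 : GaugeField (F.P K) 0 (SU N))) (1 : GaugeField (F.P K) 0 (SU N))) 0 Y‖ ≤ Λ₀ * ‖Y‖)
        (X : PBond (F.P K) 0 → lieSU (Fin N)),
        ‖fderiv ℝ (msChart F N K k 𝔹 W U₀) 0 X i‖ ≤ Λ₀ * ‖X‖ + C * δ * p X := by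
  obtain ⟨C, ρ, hC, hρ, hδ₂⟩ := exists_delta2_letter_component_sharp (F := F) (N := N) (K := K) k Q hQ0 hQs p hp
  refine ⟨C, ρ, hC, hρ, fun 𝔹 h𝔹 hk W U₀ hU hsb i u δ hδ0 hδρ hflat Λ₀ hΛ₀ hΛ X => ?_⟩
  let Ad := fun (g : SU N) => T4AdjointCovarianceUnitary.specialUnitaryAd g
  let Wu : MSField (F.P K) (SU N) := fun j c => B16Sect1Backgrounds.toMS u j c.src * W j c * (B16Sect1Backgrounds.toMS u j c.tgt)⁻¹
  let Uu : GaugeField (F.P K) 0 (SU N) := GaugeField.gaugeAct u U₀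
  let AX : PBond (F.P K) 0 → lieSU (Fin N) := fun b => Ad (u b.tgt) (X b)
  have hsbu : SmallBelow (avOfRecord F N K) k Uu := smallBelow_gaugeAct (P := F.P K) hk u hsb
  have hUu : AgreeOn 𝔹 (avgFamily (avOfRecord F N K) Uu) Wu := by
    intro j c hc
    by_cases hj : j ≤ k
    · show Averaging.iter (avOfRecord F N K) j (GaugeField.gaugeAct u U₀) c = _
      rw [B16Sect1Backgrounds.iter_gaugeAct (avOfRecord F N K) u U₀ j (hj.trans hk)]
      show B16Sect1Backgrounds.toMS u j c.src * Averaging.iter (avOfRecord F N K) j U₀ c * (B16Sect1Backgrounds.toMS u j c.tgt)⁻¹ = _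
      rw [show Averaging.iter (avOfRecord F N K) j U₀ c = W j c from hU j c hc]
    · exfalso
      rw [h𝔹 j (lt_of_not_ge hj)] at hc
      simp [bondsOf] at hc
  have hΨu : DifferentiableAt ℝ (msChart F N K k 𝔹 Wu Uu) 0 := differentiableAt_msChart hUu hsbu
  have hcov := fderiv_msChart_gaugeAct_apply (F := F) h𝔹 hk u hU hsb X i
  have hd := hδ₂ 𝔹 Wu Uu h𝔹 hk hUu hΨu i hδ0 hδρ hflat AX
  have hAXn : ‖AX‖ ≤ ‖X‖ := (pi_norm_le_iff_of_nonneg (norm_nonneg X)).2 fun b => by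
    show ‖Ad (u b.tgt) (X b)‖ ≤ ‖X‖
    rw [T4AdjointCovarianceUnitary.norm_specialUnitaryAd]; exact norm_le_pi_norm X b
  have h1 : ‖fderiv ℝ (msChart F N K k 𝔹 W U₀) 0 X i‖ = ‖fderiv ℝ (msChart F N K k 𝔹 Wu Uu) 0 AX i‖ := by
    rw [show fderiv ℝ (msChart F N K k 𝔹 Wu Uu) 0 AX i = _ from hcov, T4AdjointCovarianceUnitary.norm_specialUnitaryAd]
  rw [h1]
  set Φ1 := fderiv ℝ (msChart F N K k 𝔹 (avgFamily (avOfRecord F N K) (1 : GaugeField (F.P K) 0 (SU N))) (1 : GaugeField (F.P K) 0 (SU N))) 0 with hΦ1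
  calc ‖fderiv ℝ (msChart F N K k 𝔹 Wu Uu) 0 AX i‖
      ≤ ‖Φ1 AX i‖ + ‖fderiv ℝ (msChart F N K k 𝔹 Wu Uu) 0 AX i - Φ1 AX i‖ := norm_le_insert' _ _
    _ ≤ Λ₀ * ‖AX‖ + C * δ * p AX := add_le_add ((norm_le_pi_norm _ i).trans (hΛ AX)) hd
    _ ≤ Λ₀ * ‖X‖ + C * δ * p X :=
        add_le_add (mul_le_mul_of_nonneg_left hAXn hΛ₀) (mul_le_mul_of_nonneg_left (hpAd (fun b => u b.tgt) X) (mul_nonneg hC hδ0))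

/-! ## §5  The CURVED site block: from a flat site block and one flattening gauge, by a Neumann series on the rows at `y′` -/

/-- ★★★ **THE CURVED SITE BLOCK, LOCAL EDITION** (dag-n12-w6 g9: the letter `p ≤ C_p‖·‖` is asked on the RANGE of the flat block `Φ` only — its one use).  Original text:  ONE `C ≥ 0`, `ρ > 0` per height (the (δ₂)♯ constants for the seminorm `p`, `p ≤ Cp‖·‖`) such that: for every determining set `𝐁` with no member above
`k ≤ m + K`, every datum `W` and `U₀` in its fibre with the guard below `k`, every site `y′` of `T^{(n+1)}` (`n + 1 ≤ k`), every REAL-LINEAR FLAT SITE BLOCK `Φ` at `y′`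
(`Q^{(n+1)}(↑Φ v)(c) = ↑(v c)` on the rows at `y′`, `‖Φ v‖ ≤ CΦ‖v‖`), and every fine gauge transformation `u` such that `U₀^u` is `δ`-near-flat on the SHARP towers of the rows at `y′`
with `δ < ρ` and `C·δ·Cp·CΦ ≤ 1∕2`: EVERY target on the constrained rows at `y′` is attained EXACTLY by the chart derivative at the CURVED `U₀` on a direction `X` in the `Ad(u)⁻¹`-image of
the range of `Φ`, with `‖X‖ ≤ 2CΦ·‖t‖` (covariance §4 + (δ₂)♯ §3 + flat identity + dag-n10-w1's `exists_rightInverse_of_approx`).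
[cite: Balaban1985Variational, (44)-(48) p.285, (153) p.301; Balaban1989LargeFieldII, p.357, (1.12)-(1.13) p.359; Balaban1988Convergent, (2.10)-(2.13) pp.256-257; Balaban1987RG1, (0.4) p.253] -/
theorem exists_curved_siteBlock_local (k : ℕ)
    (Q : (i : ℕ) → (PBond (F.P K) 0 → Matrix (Fin N) (Fin N) ℂ) → PBond (F.P K) i → Matrix (Fin N) (Fin N) ℂ)
    (hQ0 : ∀ Y, Q 0 Y = Y) (hQs : ∀ (i : ℕ) (Y : PBond (F.P K) 0 → Matrix (Fin N) (Fin N) ℂ) (c : PBond (F.P K) (i + 1)), Q (i + 1) Y c = linAvg (Q i Y) c)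
    (p : Seminorm ℝ (PBond (F.P K) 0 → lieSU (Fin N)))
    (hp : ∀ Y : PBond (F.P K) 0 → lieSU (Fin N), ∑ b, ‖(Y b : Matrix (Fin N) (Fin N) ℂ)‖ ^ 2 ≤ p Y ^ 2) :
    ∃ C ρ : ℝ, 0 ≤ C ∧ 0 < ρ ∧
      ∀ (𝔹 : DetSet (F.P K)) (_ : ∀ j, k < j → 𝔹 j = ∅) (_ : k ≤ (F.P K).m + (F.P K).K) (W : MSField (F.P K) (SU N)) (U₀ : GaugeField (F.P K) 0 (SU N))
        (_ : AgreeOn 𝔹 (avgFamily (avOfRecord F N K) U₀) W) (_ : SmallBelow (avOfRecord F N K) k U₀)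
        {n : ℕ} (hn : n + 1 ≤ k) (y' : Site (F.P K) (n + 1))
        (Φ : (PBond (F.P K) (n + 1) → lieSU (Fin N)) →ₗ[ℝ] (PBond (F.P K) 0 → lieSU (Fin N))) {CΦ : ℝ} (_ : 0 ≤ CΦ)
        (_ : ∀ (v : PBond (F.P K) (n + 1) → lieSU (Fin N)) (c : PBond (F.P K) (n + 1)), (c.src = y' ∨ c.tgt = y') →
          Q (n + 1) (fun b => (Φ v b : Matrix (Fin N) (Fin N) ℂ)) c = (v c : Matrix (Fin N) (Fin N) ℂ))
        (_ : ∀ v, ‖Φ v‖ ≤ CΦ * ‖v‖)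
        {Cp : ℝ} (_ : 0 ≤ Cp) (_ : ∀ v, p (Φ v) ≤ Cp * ‖Φ v‖)
        (u : GaugeTransf (F.P K) 0 (SU N)) ⦃δ : ℝ⦄ (_ : 0 ≤ δ) (_ : δ < ρ) (_ : C * δ * (Cp * CΦ) ≤ 1 / 2)
        (_ : ∀ c : PBond (F.P K) (n + 1), (c.src = y' ∨ c.tgt = y') → ∀ b₀ : PBond (F.P K) 0,
          (iterBlockOf (n + 1) b₀.src = c.src ∨ iterBlockOf (n + 1) b₀.src = c.tgt) →
          (iterBlockOf (n + 1) b₀.tgt = c.src ∨ iterBlockOf (n + 1) b₀.tgt = c.tgt) →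
          ‖((GaugeField.gaugeAct u U₀ b₀ : SU N) : Matrix (Fin N) (Fin N) ℂ) - 1‖ ≤ δ),
      ∀ t : PBond (F.P K) (n + 1) → lieSU (Fin N),
        ∃ X : PBond (F.P K) 0 → lieSU (Fin N),
          (∀ (c : PBond (F.P K) (n + 1)) (hc : c ∈ bondsOf (𝔹 (n + 1))), (c.src = y' ∨ c.tgt = y') →
            fderiv ℝ (msChart F N K k 𝔹 W U₀) 0 X (constrEnum 𝔹 k ⟨⟨n + 1, Nat.lt_succ_of_le hn⟩, c, hc⟩) = t c) ∧
          (∀ b : PBond (F.P K) 0, X b ≠ 0 → ∃ v, Φ v b ≠ 0) ∧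
          ‖X‖ ≤ 2 * CΦ * ‖t‖ := by
  classical
  obtain ⟨C, ρ, hC, hρ, hδ₂⟩ := exists_delta2_letter_component_sharp (F := F) (N := N) (K := K) k Q hQ0 hQs p hp
  refine ⟨C, ρ, hC, hρ, fun 𝔹 h𝔹 hk W U₀ hU hsb n hn y' Φ CΦ hCΦ hΦ hΦn Cp hCp hpn u δ hδ0 hδρ hδC hflat t₀ => ?_⟩
  -- ### notation
  let S : Type := {c : PBond (F.P K) (n + 1) // c ∈ bondsOf (𝔹 (n + 1)) ∧ (c.src = y' ∨ c.tgt = y')}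
  let ι : S → Fin (constrCard 𝔹 k) := fun c => constrEnum 𝔹 k ⟨⟨n + 1, Nat.lt_succ_of_le hn⟩, c.1, c.2.1⟩
  have hι : ∀ c : S, (constrEnum 𝔹 k).symm (ι c) = ⟨⟨n + 1, Nat.lt_succ_of_le hn⟩, c.1, c.2.1⟩ := fun c => Equiv.symm_apply_apply _ _
  let Ad := fun (g : SU N) => T4AdjointCovarianceUnitary.specialUnitaryAd g
  let ū : Site (F.P K) (n + 1) → SU N := fun y => B16Sect1Backgrounds.toMS u (n + 1) y
  let Wu : MSField (F.P K) (SU N) := fun j c => B16Sect1Backgrounds.toMS u j c.src * W j c * (B16Sect1Backgrounds.toMS u j c.tgt)⁻¹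
  let Uu : GaugeField (F.P K) 0 (SU N) := GaugeField.gaugeAct u U₀
  let Ψ := msChart F N K k 𝔹 W U₀
  let t : S → lieSU (Fin N) := fun c => t₀ c.1
  have htn : ‖t‖ ≤ ‖t₀‖ := (pi_norm_le_iff_of_nonneg (norm_nonneg t₀)).2 fun c => norm_le_pi_norm t₀ c.1
  -- ### the transformed pair is guarded and in its fibre
  have hsbu : SmallBelow (avOfRecord F N K) k Uu := smallBelow_gaugeAct (P := F.P K) hk u hsb
  have hUu : AgreeOn 𝔹 (avgFamily (avOfRecord F N K) Uu) Wu := by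
    intro j c hc
    by_cases hj : j ≤ k
    · show Averaging.iter (avOfRecord F N K) j (GaugeField.gaugeAct u U₀) c = _
      rw [B16Sect1Backgrounds.iter_gaugeAct (avOfRecord F N K) u U₀ j (hj.trans hk)]
      show B16Sect1Backgrounds.toMS u j c.src * Averaging.iter (avOfRecord F N K) j U₀ c * (B16Sect1Backgrounds.toMS u j c.tgt)⁻¹ = _
      rw [show Averaging.iter (avOfRecord F N K) j U₀ c = W j c from hU j c hc]
    · exfalso
      rw [h𝔹 j (lt_of_not_ge hj)] at hc
      simp [bondsOf] at hc
  have hΨu : DifferentiableAt ℝ (msChart F N K k 𝔹 Wu Uu) 0 := differentiableAt_msChart hUu hsbu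
  -- ### the linear maps: the rows at `y′` of the chart derivative; extension by the twisted target; the column candidate
  let T : (PBond (F.P K) 0 → lieSU (Fin N)) →ₗ[ℝ] (S → lieSU (Fin N)) :=
    { toFun := fun X c => fderiv ℝ Ψ 0 X (ι c)
      map_add' := fun X X' => funext fun c => by simp only [map_add, Pi.add_apply]
      map_smul' := fun r X => funext fun c => by simp only [map_smul, Pi.smul_apply, RingHom.id_apply] }
  let ext : (S → lieSU (Fin N)) →ₗ[ℝ] (PBond (F.P K) (n + 1) → lieSU (Fin N)) :=
    { toFun := fun t c => if h : c ∈ bondsOf (𝔹 (n + 1)) ∧ (c.src = y' ∨ c.tgt = y') then Ad (ū c.tgt) (t ⟨c, h⟩) else 0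
      map_add' := fun t t' => funext fun c => by
        by_cases h : c ∈ bondsOf (𝔹 (n + 1)) ∧ (c.src = y' ∨ c.tgt = y')
        · simp only [dif_pos h, Pi.add_apply, map_add]
        · simp only [dif_neg h, Pi.add_apply, add_zero]
      map_smul' := fun r t => funext fun c => by
        by_cases h : c ∈ bondsOf (𝔹 (n + 1)) ∧ (c.src = y' ∨ c.tgt = y')
        · simp only [dif_pos h, Pi.smul_apply, map_smul, RingHom.id_apply]
        · simp only [dif_neg h, Pi.smul_apply, smul_zero, RingHom.id_apply] }
  have hext : ∀ t (c : S), ext t c.1 = Ad (ū c.1.tgt) (t c) := fun t c => by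
    show (if h : c.1 ∈ bondsOf (𝔹 (n + 1)) ∧ (c.1.src = y' ∨ c.1.tgt = y') then Ad (ū c.1.tgt) (t ⟨c.1, h⟩) else 0) = _
    rw [dif_pos c.2]
  have hextn : ∀ t, ‖ext t‖ ≤ ‖t‖ := fun t => by
    refine (pi_norm_le_iff_of_nonneg (norm_nonneg t)).2 fun c => ?_
    show ‖(if h : c ∈ bondsOf (𝔹 (n + 1)) ∧ (c.src = y' ∨ c.tgt = y') then Ad (ū c.tgt) (t ⟨c, h⟩) else 0)‖ ≤ ‖t‖
    by_cases h : c ∈ bondsOf (𝔹 (n + 1)) ∧ (c.src = y' ∨ c.tgt = y')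
    · rw [dif_pos h, T4AdjointCovarianceUnitary.norm_specialUnitaryAd]; exact norm_le_pi_norm t ⟨c, h⟩
    · rw [dif_neg h, norm_zero]; exact norm_nonneg t
  let Adinv : (PBond (F.P K) 0 → lieSU (Fin N)) →ₗ[ℝ] (PBond (F.P K) 0 → lieSU (Fin N)) :=
    { toFun := fun Y b => Ad (u b.tgt)⁻¹ (Y b)
      map_add' := fun Y Y' => funext fun b => by simp only [Pi.add_apply, map_add]
      map_smul' := fun r Y => funext fun b => by simp only [Pi.smul_apply, map_smul, RingHom.id_apply] }
  have hAdinv : ∀ Y b, Adinv Y b = Ad (u b.tgt)⁻¹ (Y b) := fun _ _ => rfl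
  have hAdinvn : ∀ Y, ‖Adinv Y‖ ≤ ‖Y‖ := fun Y =>
    (pi_norm_le_iff_of_nonneg (norm_nonneg Y)).2 fun b => by
      rw [hAdinv, T4AdjointCovarianceUnitary.norm_specialUnitaryAd]; exact norm_le_pi_norm Y b
  let H₀ : (S → lieSU (Fin N)) →ₗ[ℝ] (PBond (F.P K) 0 → lieSU (Fin N)) := Adinv ∘ₗ Φ ∘ₗ ext
  have hH₀ : ∀ t, H₀ t = Adinv (Φ (ext t)) := fun _ => rfl
  -- `Ad(u) ∘ Adinv = id`
  have hAdAdinv : ∀ Y, (fun b => Ad (u b.tgt) (Adinv Y b)) = Y := fun Y => funext fun b => by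
    rw [hAdinv]
    have := T4AdjointCovarianceUnitary.specialUnitaryAd_inv_apply (u b.tgt)⁻¹ (Y b)
    rw [inv_inv] at this
    exact this
  -- ### the approximation: covariance + (δ₂)♯ + the flat identity
  have happrox : ∀ t, ‖T (H₀ t) - t‖ ≤ (1 / 2) * ‖t‖ := by
    intro t
    have hY := hΦn (ext t)
    refine (pi_norm_le_iff_of_nonneg (by positivity)).2 fun c => ?_
    rw [Pi.sub_apply]
    show ‖fderiv ℝ Ψ 0 (H₀ t) (ι c) - t c‖ ≤ 1 / 2 * ‖t‖
    -- covariance: the transformed chart on `Φ (ext t)` reads `Ad` of the original chart on `H₀ t`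
    have hcov0 := fderiv_msChart_gaugeAct_apply (F := F) h𝔹 hk u hU hsb (H₀ t) (ι c)
    rw [hH₀, hAdAdinv, hι c] at hcov0
    have hcov : fderiv ℝ (msChart F N K k 𝔹 Wu Uu) 0 (Φ (ext t)) (ι c) = Ad (ū c.1.tgt) (fderiv ℝ Ψ 0 (H₀ t) (ι c)) := hcov0
    -- (δ₂)♯ at the transformed pair, row `ι c`
    have hnear : ∀ b₀ : PBond (F.P K) 0,
        (iterBlockOf (((constrEnum 𝔹 k).symm (ι c)).1 : ℕ) b₀.src = ((constrEnum 𝔹 k).symm (ι c)).2.1.src ∨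
          iterBlockOf (((constrEnum 𝔹 k).symm (ι c)).1 : ℕ) b₀.src = ((constrEnum 𝔹 k).symm (ι c)).2.1.tgt) →
        (iterBlockOf (((constrEnum 𝔹 k).symm (ι c)).1 : ℕ) b₀.tgt = ((constrEnum 𝔹 k).symm (ι c)).2.1.src ∨
          iterBlockOf (((constrEnum 𝔹 k).symm (ι c)).1 : ℕ) b₀.tgt = ((constrEnum 𝔹 k).symm (ι c)).2.1.tgt) →
        ‖((Uu b₀ : SU N) : Matrix (Fin N) (Fin N) ℂ) - 1‖ ≤ δ := by
      rw [hι c]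
      exact hflat c.1 c.2.2
    have hd := hδ₂ 𝔹 Wu Uu h𝔹 hk hUu hΨu (ι c) hδ0 hδρ hnear (Φ (ext t))
    -- the flat identity at row `ι c`
    have hflatrow : fderiv ℝ (msChart F N K k 𝔹 (avgFamily (avOfRecord F N K) (1 : GaugeField (F.P K) 0 (SU N))) (1 : GaugeField (F.P K) 0 (SU N))) 0
        (Φ (ext t)) (ι c) = Ad (ū c.1.tgt) (t c) := by
      rw [Summit.QuantumFields.YangMills.BalabanUVNodes.N12FlatChartDerivIterLin.fderiv_msChart_one_apply_eq_iterLin Q hQ0 hQs 𝔹 (Φ (ext t)) (ι c), hι c]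
      show suProj N (Q (n + 1) (fun b => (Φ (ext t) b : Matrix (Fin N) (Fin N) ℂ)) c.1) = _
      rw [hΦ (ext t) c.1 c.2.2, suProj_coe, hext]
    rw [hflatrow, hcov, ← map_sub, T4AdjointCovarianceUnitary.norm_specialUnitaryAd] at hd
    calc ‖fderiv ℝ Ψ 0 (H₀ t) (ι c) - t c‖ ≤ C * δ * p (Φ (ext t)) := hd
      _ ≤ C * δ * (Cp * (CΦ * ‖t‖)) := by
          refine mul_le_mul_of_nonneg_left ((hpn _).trans (mul_le_mul_of_nonneg_left (hY.trans ?_) hCp)) (by positivity)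
          exact mul_le_mul_of_nonneg_left (hextn t) hCΦ
      _ = (C * δ * (Cp * CΦ)) * ‖t‖ := by ring
      _ ≤ 1 / 2 * ‖t‖ := mul_le_mul_of_nonneg_right hδC (norm_nonneg _)
  -- ### the Neumann step
  obtain ⟨G, hG, hGn⟩ := Summit.QuantumFields.YangMills.BalabanUVNodes.N12GuardedLinAvgRightInverse.exists_rightInverse_of_approx T H₀ (by norm_num : (1 / 2 : ℝ) < 1) happrox
  refine ⟨H₀ (G t), fun c hc hcy => ?_, fun b hb => ?_, ?_⟩
  · exact congrFun (hG t) ⟨c, hc, hcy⟩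
  · refine ⟨ext (G t), fun h => hb ?_⟩
    rw [hH₀, hAdinv, h, map_zero]
  · rw [hH₀]
    calc ‖Adinv (Φ (ext (G t)))‖ ≤ ‖Φ (ext (G t))‖ := hAdinvn _
      _ ≤ CΦ * ‖ext (G t)‖ := hΦn _
      _ ≤ CΦ * ((1 - 1 / 2)⁻¹ * ‖t‖) := mul_le_mul_of_nonneg_left ((hextn _).trans (hGn t)) hCΦ
      _ = 2 * CΦ * ‖t‖ := by rw [show ((1 : ℝ) - 1 / 2)⁻¹ = 2 by norm_num]; ring
      _ ≤ 2 * CΦ * ‖t₀‖ := mul_le_mul_of_nonneg_left htn (by positivity)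

/-! ## §6  Two bookkeeping letters for the closed-form assembly: the LOCAL seminorm letter over ≤ 2 sites, and the closed-form threshold -/

omit [NeZero N] in
/-- **THE LOCAL SEMINORM LETTER OVER TWO SITES.**  If `p(Y) ≤ C_p‖Y‖` for every `Y` vanishing off a finset of at most `2d·L^{kd}` bonds, then `p(Y) ≤ C_p‖Y‖` for every `Y` whose non-zero
bonds are sourced in the `j`-blocks over a set `S` of at most two `j`-sites (`j ≤ k ≤ m + K`): those bonds number `≤ #S·L^{jd}·d ≤ 2d·L^{kd}` (p689329 `card_hullLevel_le`).  Covers the sharp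
tower of a row (`S = {c₋, c₊}`) and the range of a flat site block (`S = {y}`). [cite: Balaban1984PropagatorsI, (1.18) p.20 (`|B^j(y)| = L^{jd}`)] -/
theorem seminorm_le_of_twoSites (hk : k ≤ (F.P K).m + (F.P K).K) {p : Seminorm ℝ (PBond (F.P K) 0 → lieSU (Fin N))} {Cp : ℝ}
    (hpT : ∀ (Y : PBond (F.P K) 0 → lieSU (Fin N)) (S : Finset (PBond (F.P K) 0)), (∀ b, b ∉ S → Y b = 0) →
      S.card ≤ 2 * (F.P K).d * ((F.P K).L ^ (F.P K).d) ^ k → p Y ≤ Cp * ‖Y‖)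
    (j : ℕ) (hj : j ≤ k) (S : Finset (Site (F.P K) j)) (hS : S.card ≤ 2) (Y : PBond (F.P K) 0 → lieSU (Fin N))
    (hY : ∀ b, Y b ≠ 0 → iterBlockOf j b.src ∈ S) : p Y ≤ Cp * ‖Y‖ := by
  classical
  have hLd : 0 < (F.P K).L ^ (F.P K).d := pow_pos (F.P K).L_pos _
  refine hpT Y ((S.biUnion (iterBlock j) ×ˢ (Finset.univ : Finset (Fin (F.P K).d))).image fun q : Site (F.P K) 0 × Fin (F.P K).d => (⟨q.1, q.2⟩ : PBond (F.P K) 0))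
    (fun b hb => ?_) ?_
  · by_contra h
    exact hb ((mem_hullLevel_iff S b).2 (hY b h))
  · calc _ ≤ S.card * ((F.P K).L ^ (F.P K).d) ^ j * (F.P K).d := card_hullLevel_le (hj.trans hk) S
      _ ≤ 2 * ((F.P K).L ^ (F.P K).d) ^ k * (F.P K).d := Nat.mul_le_mul_right _ (Nat.mul_le_mul hS (Nat.pow_le_pow_right hLd hj))
      _ = 2 * (F.P K).d * ((F.P K).L ^ (F.P K).d) ^ k := by ring

/-- **THE CLOSED-FORM THRESHOLD.**  For `C₂, C_p, C_Φ, D ≥ 0` and `ρ > 0`, `ε := min (ρ∕(2(D+1))) (1∕(4(D+1)(C₂+1)(C_pC_Φ+1)))` is positive, `D·ε < ρ`, and `C₂·(D·ε)·(C_p·C_Φ) ≤ ½`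
(the three facts `…HsurjSupportPrelim.exists_threshold` produced existentially). [cite: Balaban1985Variational, (153) p.301 (bookkeeping)] -/
theorem threshold_closedForm {C₂ Cp CΦ ρ D : ℝ} (hC₂ : 0 ≤ C₂) (hCp : 0 ≤ Cp) (hCΦ : 0 ≤ CΦ) (hρ : 0 < ρ) (hD : 0 ≤ D) :
    0 < min (ρ / (2 * (D + 1))) (1 / (4 * (D + 1) * (C₂ + 1) * (Cp * CΦ + 1))) ∧
      D * min (ρ / (2 * (D + 1))) (1 / (4 * (D + 1) * (C₂ + 1) * (Cp * CΦ + 1))) < ρ ∧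
      C₂ * (D * min (ρ / (2 * (D + 1))) (1 / (4 * (D + 1) * (C₂ + 1) * (Cp * CΦ + 1)))) * (Cp * CΦ) ≤ 1 / 2 := by
  set M : ℝ := Cp * CΦ with hM_def
  have hM : 0 ≤ M := mul_nonneg hCp hCΦ
  set e₁ : ℝ := ρ / (2 * (D + 1)) with he₁
  set e₂ : ℝ := 1 / (4 * (D + 1) * (C₂ + 1) * (M + 1)) with he₂
  have hden : 0 < 4 * (D + 1) * (C₂ + 1) * (M + 1) := by positivity
  have he₁0 : 0 < e₁ := by rw [he₁]; positivity
  have he₂0 : 0 < e₂ := by rw [he₂]; positivity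
  refine ⟨lt_min he₁0 he₂0, ?_, ?_⟩
  · calc D * min e₁ e₂ ≤ D * e₁ := mul_le_mul_of_nonneg_left (min_le_left _ _) hD
      _ = ρ * (D / (2 * (D + 1))) := by rw [he₁]; ring
      _ ≤ ρ * (1 / 2) := by
          refine mul_le_mul_of_nonneg_left ?_ hρ.le
          rw [div_le_iff₀ (by positivity)]; linarith
      _ < ρ := by linarith
  · have h3 : C₂ * D * M ≤ (C₂ + 1) * (D + 1) * (M + 1) := by
      nlinarith [mul_nonneg hC₂ hD, mul_nonneg hC₂ hM, mul_nonneg hD hM, mul_nonneg (mul_nonneg hC₂ hD) hM]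
    calc C₂ * (D * min e₁ e₂) * M ≤ C₂ * (D * e₂) * M := by
          refine mul_le_mul_of_nonneg_right (mul_le_mul_of_nonneg_left (mul_le_mul_of_nonneg_left (min_le_right _ _) hD) hC₂) hM
      _ = C₂ * D * M / (4 * (D + 1) * (C₂ + 1) * (M + 1)) := by rw [he₂]; ring
      _ ≤ (C₂ + 1) * (D + 1) * (M + 1) / (4 * (D + 1) * (C₂ + 1) * (M + 1)) := div_le_div_of_nonneg_right h3 hden.le
      _ = 1 / 4 := by field_simp
      _ ≤ 1 / 2 := by norm_num

end Record

end Summit.QuantumFields.YangMills.BalabanUVNodes.N12DirectSurjSiteBlockCurvedLocal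

end
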